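/-
Copyright (c) 2026 the pub-hodgecm-mathlib formalisation cell (harness21).  Prover seat hodgecm-mathlib-K2E5-p16 (g6), Track B «K2-LIT»,
#184♮ = hLiu418 = `stmt-HodgeConjecture-24832`; A7-val ROAD (σ) «NULL-CONE MULTIPLICITY ONE», file V5b-gen PART 2 `K2LiuNullConeMultiplicityOneStratified`
(K2Liu-p09 (g6) organ-lead word 11:49:58Z): MULTIPLICITY ONE ON A STRATIFIED NULL CONE — the split-place twin of ★ V5.
THEOREMS ONLY (no `def`, no `instance`, no notation, no named-fact hypothesis, no `sorry`).
-/
import Summits.HodgeConjecture.HodgeConjecture.Theorems.K2LiuNullConeStratumPeeling   -- ★ (this seat) V5b-gen part 1: the one-stratum engine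
import Mathlib.MeasureTheory.Function.LocallyIntegrable
import HarnessLib

/-!
# Crux `HLiu418`, A7-val road (σ), V5b-gen part 2: multiplicity one for functionals living on a STRATIFIED null cone

Cell `hodgecm-mathlib`, crux item hLiu418 = `stmt-HodgeConjecture-24832` (helper lane `--supports`, count-neutral).

THE THEOREM (`exists_forall_apply_eq_const_mul_of_stratified`; ★ V5's ambient and conclusion BYTE-IDENTICAL).  `Γ` t.d. σ-compact with a compact open `K₀`,
`χ : Γ →* ℂ` trivial on `K₀`; `X` a Hausdorff locally compact `Γ`-space; a CHAIN `N : ℕ → Set X` of closed `Γ`-stable sets with `N 0 = ∅`, strata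
`N (i+1) ∖ N i` (`i < r`) each ONE `Γ`-orbit with the extension property (every lcc function on the stratum is `F|` for an lcc `F` vanishing on `N i`), and for
every `i < r` except the LINE index `i₀` a WRONG-CHARACTER WITNESS (★ part 1 currency: `x₀` in the stratum, `γ₀ • x₀ = x₀`, `χ′` trivial on `K₀` with
`χ γ₀ ≠ χ′ γ₀`, a reference functional `T′` — `χ′`-semi-invariant on the lcc `F` vanishing on `N i`, killing those vanishing on `N (i+1)`, non-degenerate).
If `T₁, T₂` are `χ`-semi-invariant on the lcc functions, kill the lcc functions vanishing on `N r`, and `T₁ ≠ 0`, then **`∃ c, ∀ F lcc, T₂ F = c · T₁ F`**.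
PROOF.  Peel `T₁, T₂` from `N r` down to `N (i₀+1)` (★ part 1 `kills_of_wrongChar_stratum`); at the line stratum ★ part 1 `exists_const_of_line_stratum` gives `c`
(or `T₁` kills the stratum); peel `T₂ − c·T₁` (resp. `T₁`) down to `N 0 = ∅`.
WITNESS BUILDERS (§2): the VERTEX `{o}` is the stratum `({o}, ∅)` with `T′ = δ_o = LinearMap.proj o`, `χ′ = 1` (★ V5's `hfix ∕ hL ∕ γ₀ ∕ hγ₀` binders):
`vertex_transitive`, `vertex_extension`, `vertex_witness`; a RELATIVELY INVARIANT Radon measure `μ` on a stratum `M ∖ M′` gives the reference functional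
`T′ F = ∫ F|_{M∖M′} dμ`: `exists_witness_of_measure`.
Consumer: V5-split-inst (K2Liu-p09), fed by ★ V3 (O2) `K2LiuNullConeOrbitsSplit` (K2Liu-p14): the seven strata `O_{ij}`, the line `O_{11}`.
References: [Rallis1984]; [KudlaRallis1990, §2–3]; [KudlaSweet1997, §§2–4]; [BernsteinZelevinsky1976, §1.5, §1.18].
HONEST LABEL: HC_CM is proved only modulo the 7 printed citations (2 remaining named inputs: hLiu418 = stmt-HodgeConjecture-24832,
h413 = stmt-HodgeConjecture-24833) until rung 0 closes; count-neutral helper, closes no socket.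
-/

set_option autoImplicit false
set_option linter.dupNamespace false

noncomputable section

open Set Filter Topology MulAction MeasureTheory Literature.Topology
open scoped Pointwise
open Summit.HodgeConjecture.HodgeConjecture.Cruxes.HLiu418.K2LiuNullConeStratumPeeling

namespace Summit.HodgeConjecture.HodgeConjecture.Cruxes.HLiu418.K2LiuNullConeMultiplicityOneStratified

/-! ## §1  The chain theorem -/

section Chain

variable {Γ : Type*} [Group Γ] [TopologicalSpace Γ] [IsTopologicalGroup Γ] [TotallyDisconnectedSpace Γ] [SigmaCompactSpace Γ]
  {X : Type*} [TopologicalSpace X] [T2Space X] [LocallyCompactSpace X] [MulAction Γ X] [ContinuousSMul Γ X]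

/-- **MULTIPLICITY ONE ON A STRATIFIED NULL CONE.**  See the module docstring; the conclusion is ★ V5's. [Rallis1984; KudlaRallis1990, §2–3;
KudlaSweet1997, §§2–4] -/
theorem exists_forall_apply_eq_const_mul_of_stratified (K₀ : Subgroup Γ) (hK₀o : IsOpen (K₀ : Set Γ)) (hK₀c : IsCompact (K₀ : Set Γ))
    (χ : Γ →* ℂ) (hχ : ∀ k ∈ K₀, χ k = 1)
    (N : ℕ → Set X) (r i₀ : ℕ) (hi₀ : i₀ < r) (hN0 : N 0 = ∅) (hNc : ∀ i, IsClosed (N i))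
    (hNΓ : ∀ (i : ℕ) (γ : Γ), ∀ x ∈ N i, γ • x ∈ N i)
    (htrans : ∀ i, i < r → ∀ x ∈ N (i + 1) \ N i, ∀ y ∈ N (i + 1) \ N i, ∃ γ : Γ, γ • x = y)
    (hext : ∀ i, i < r → ∀ f : ↥(N (i + 1) \ N i) → ℂ, IsLocallyConstant f → HasCompactSupport f →
      ∃ F : X → ℂ, IsLocallyConstant F ∧ HasCompactSupport F ∧ (∀ x ∈ N i, F x = 0) ∧ ∀ z : ↥(N (i + 1) \ N i), F z = f z)
    (hwit : ∀ i, i < r → i ≠ i₀ → ∃ x₀ ∈ N (i + 1) \ N i, ∃ γ₀ : Γ, γ₀ • x₀ = x₀ ∧ ∃ χ' : Γ →* ℂ, (∀ k ∈ K₀, χ' k = 1) ∧ χ γ₀ ≠ χ' γ₀ ∧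
      ∃ T' : (X → ℂ) →ₗ[ℂ] ℂ,
        (∀ F : X → ℂ, IsLocallyConstant F → HasCompactSupport F → (∀ x ∈ N i, F x = 0) → ∀ γ : Γ, T' (fun z => F (γ • z)) = χ' γ * T' F) ∧
        (∀ F : X → ℂ, IsLocallyConstant F → HasCompactSupport F → (∀ x ∈ N (i + 1), F x = 0) → T' F = 0) ∧
        ∃ F₁ : X → ℂ, IsLocallyConstant F₁ ∧ HasCompactSupport F₁ ∧ (∀ x ∈ N i, F₁ x = 0) ∧ T' F₁ ≠ 0)
    (T₁ T₂ : (X → ℂ) →ₗ[ℂ] ℂ)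
    (hT₁ : ∀ F : X → ℂ, IsLocallyConstant F → HasCompactSupport F → ∀ γ : Γ, T₁ (fun z => F (γ • z)) = χ γ * T₁ F)
    (hT₂ : ∀ F : X → ℂ, IsLocallyConstant F → HasCompactSupport F → ∀ γ : Γ, T₂ (fun z => F (γ • z)) = χ γ * T₂ F)
    (hT₁N : ∀ F : X → ℂ, IsLocallyConstant F → HasCompactSupport F → (∀ x ∈ N r, F x = 0) → T₁ F = 0)
    (hT₂N : ∀ F : X → ℂ, IsLocallyConstant F → HasCompactSupport F → (∀ x ∈ N r, F x = 0) → T₂ F = 0)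
    {F₀ : X → ℂ} (hF₀ : IsLocallyConstant F₀) (hF₀s : HasCompactSupport F₀) (hne : T₁ F₀ ≠ 0) :
    ∃ c : ℂ, ∀ F : X → ℂ, IsLocallyConstant F → HasCompactSupport F → T₂ F = c * T₁ F := by
  classical
  -- one peel at a non-line stratum `i`
  have peel : ∀ (T : (X → ℂ) →ₗ[ℂ] ℂ), (∀ F : X → ℂ, IsLocallyConstant F → HasCompactSupport F → ∀ γ : Γ, T (fun z => F (γ • z)) = χ γ * T F) →
      ∀ i, i < r → i ≠ i₀ → (∀ F : X → ℂ, IsLocallyConstant F → HasCompactSupport F → (∀ x ∈ N (i + 1), F x = 0) → T F = 0) →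
        ∀ F : X → ℂ, IsLocallyConstant F → HasCompactSupport F → (∀ x ∈ N i, F x = 0) → T F = 0 := by
    intro T hT i hi hii₀ hTi F hF hFs hF0
    obtain ⟨x₀, hx₀, γ₀, hγ₀, χ', hχ', hχγ, T', hT', hT'M, hT'ne⟩ := hwit i hi hii₀
    exact kills_of_wrongChar_stratum K₀ hK₀o hK₀c χ hχ (N (i + 1)) (N i) (hNc _) (hNc _) (hNΓ _) (hNΓ _) (htrans i hi) (hext i hi)
      x₀ hx₀ γ₀ hγ₀ χ' hχ' hχγ T' hT' hT'M hT'ne T (fun F hF hFs _ γ => hT F hF hFs γ) hTi hF hFs hF0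
  -- iterate from level `a + n` down to level `a` through non-line strata
  have peel_down : ∀ (T : (X → ℂ) →ₗ[ℂ] ℂ), (∀ F : X → ℂ, IsLocallyConstant F → HasCompactSupport F → ∀ γ : Γ, T (fun z => F (γ • z)) = χ γ * T F) →
      ∀ a n : ℕ, a + n ≤ r → (∀ i, a ≤ i → i < a + n → i ≠ i₀) →
        (∀ F : X → ℂ, IsLocallyConstant F → HasCompactSupport F → (∀ x ∈ N (a + n), F x = 0) → T F = 0) →
          ∀ F : X → ℂ, IsLocallyConstant F → HasCompactSupport F → (∀ x ∈ N a, F x = 0) → T F = 0 := by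
    intro T hT a n
    induction n with
    | zero =>
        intro _ _ h
        simpa only [Nat.add_zero] using h
    | succ n ih =>
        intro hle hne h
        refine ih (by omega) (fun i h1 h2 => hne i h1 (by omega)) ?_
        exact peel T hT (a + n) (by omega) (hne (a + n) (by omega) (by omega)) h
  have hempty : ∀ (F : X → ℂ), ∀ x ∈ N 0, F x = 0 := fun F x hx => by
    rw [hN0] at hx
    exact absurd hx (Set.notMem_empty x)
  -- Stage A: from `N r` down to `N (i₀ + 1)`
  have hr : i₀ + 1 + (r - (i₀ + 1)) = r := by omega
  have hA₁ : ∀ F : X → ℂ, IsLocallyConstant F → HasCompactSupport F → (∀ x ∈ N (i₀ + 1), F x = 0) → T₁ F = 0 :=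
    peel_down T₁ hT₁ (i₀ + 1) (r - (i₀ + 1)) (by omega) (fun i h1 _ => by omega) (by rw [hr]; exact hT₁N)
  have hA₂ : ∀ F : X → ℂ, IsLocallyConstant F → HasCompactSupport F → (∀ x ∈ N (i₀ + 1), F x = 0) → T₂ F = 0 :=
    peel_down T₂ hT₂ (i₀ + 1) (r - (i₀ + 1)) (by omega) (fun i h1 _ => by omega) (by rw [hr]; exact hT₂N)
  -- Stage B: the line stratum `N (i₀ + 1) ∖ N i₀`
  by_cases hB : ∃ F₁ : X → ℂ, IsLocallyConstant F₁ ∧ HasCompactSupport F₁ ∧ (∀ x ∈ N i₀, F₁ x = 0) ∧ T₁ F₁ ≠ 0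
  · obtain ⟨c, hc⟩ := exists_const_of_line_stratum K₀ hK₀o hK₀c χ hχ (N (i₀ + 1)) (N i₀) (hNc _) (hNc _) (hNΓ _) (hNΓ _)
      (htrans i₀ hi₀) (hext i₀ hi₀) T₁ T₂ (fun F hF hFs _ γ => hT₁ F hF hFs γ) (fun F hF hFs _ γ => hT₂ F hF hFs γ) hA₁ hA₂ hB
    -- Stage C: peel `D := T₂ − c·T₁` down to `N 0 = ∅`
    have hDχ : ∀ F : X → ℂ, IsLocallyConstant F → HasCompactSupport F → ∀ γ : Γ,
        (T₂ - c • T₁) (fun z => F (γ • z)) = χ γ * (T₂ - c • T₁) F := by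
      intro F hF hFs γ
      simp only [LinearMap.sub_apply, LinearMap.smul_apply, hT₁ F hF hFs γ, hT₂ F hF hFs γ, smul_eq_mul]
      ring
    have hD : ∀ F : X → ℂ, IsLocallyConstant F → HasCompactSupport F → (∀ x ∈ N (0 + i₀), F x = 0) → (T₂ - c • T₁) F = 0 := by
      intro F hF hFs hF0
      rw [Nat.zero_add] at hF0
      rw [LinearMap.sub_apply, LinearMap.smul_apply, hc F hF hFs hF0, smul_eq_mul, sub_self]
    have hD0 := peel_down (T₂ - c • T₁) hDχ 0 i₀ (by omega) (fun i _ h2 => by omega) hD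
    refine ⟨c, fun F hF hFs => ?_⟩
    have h := hD0 F hF hFs (hempty F)
    rw [LinearMap.sub_apply, LinearMap.smul_apply, smul_eq_mul, sub_eq_zero] at h
    exact h
  · -- `T₁` kills the line stratum: peel `T₁` down to `∅` and contradict `T₁ F₀ ≠ 0`
    exfalso
    push Not at hB
    have hB' : ∀ F : X → ℂ, IsLocallyConstant F → HasCompactSupport F → (∀ x ∈ N (0 + i₀), F x = 0) → T₁ F = 0 := by
      intro F hF hFs hF0
      rw [Nat.zero_add] at hF0
      exact hB F hF hFs hF0
    have h0 := peel_down T₁ hT₁ 0 i₀ (by omega) (fun i _ h2 => by omega) hB'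
    exact hne (h0 F₀ hF₀ hF₀s (hempty F₀))

end Chain

/-! ## §2  Witness builders: the vertex, and relatively invariant measures on a stratum -/

section Vertex

variable {Γ : Type*} [Group Γ] {X : Type*} [TopologicalSpace X] [T2Space X] [MulAction Γ X]

omit [TopologicalSpace X] [T2Space X] in
/-- The vertex stratum `{o} ∖ ∅` is one orbit. [folklore] -/
theorem vertex_transitive (o : X) :
    ∀ x ∈ ({o} : Set X) \ (∅ : Set X), ∀ y ∈ ({o} : Set X) \ (∅ : Set X), ∃ γ : Γ, γ • x = y := by
  intro x hx y hy
  refine ⟨1, ?_⟩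
  rw [one_smul, Set.mem_singleton_iff.1 hx.1, Set.mem_singleton_iff.1 hy.1]

/-- **The vertex has the extension property**: a (locally constant) function on `{o}` extends to the lcc function `1_L · f(o)` for a compact clopen `L ∋ o`.
[BernsteinZelevinsky1976, §1.1] -/
theorem vertex_extension (o : X) (hL : ∃ L : Set X, IsClopen L ∧ IsCompact L ∧ o ∈ L) :
    ∀ f : ↥(({o} : Set X) \ (∅ : Set X)) → ℂ, IsLocallyConstant f → HasCompactSupport f →
      ∃ F : X → ℂ, IsLocallyConstant F ∧ HasCompactSupport F ∧ (∀ x ∈ (∅ : Set X), F x = 0) ∧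
        ∀ z : ↥(({o} : Set X) \ (∅ : Set X)), F z = f z := by
  intro f _ _
  obtain ⟨L, hLc, hLK, hoL⟩ := hL
  have ho : o ∈ ({o} : Set X) \ (∅ : Set X) := ⟨Set.mem_singleton o, Set.notMem_empty o⟩
  refine ⟨L.indicator fun _ => f ⟨o, ho⟩, isLocallyConstant_indicator_of_isClopen hLc (IsLocallyConstant.const _),
    hasCompactSupport_indicator_of_isCompact hLK _, fun x hx => absurd hx (Set.notMem_empty x), fun z => ?_⟩
  have hz : (z : X) = o := Set.mem_singleton_iff.1 z.2.1
  have hz' : z = ⟨o, ho⟩ := Subtype.ext hz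
  rw [hz, Set.indicator_of_mem hoL, hz']

/-- **THE VERTEX WITNESS** in the currency of ★ part 1: `x₀ = o`, `γ₀` with `χ γ₀ ≠ 1` (`o` is `Γ`-fixed), `χ′ = 1`, `T′ = δ_o = LinearMap.proj o`
(`1`-semi-invariant, kills the lcc functions vanishing on `{o}`, `δ_o(1_L) = 1 ≠ 0`). [BernsteinZelevinsky1976, §1.18; KudlaRallis1990, §2] -/
theorem vertex_witness (K₀ : Subgroup Γ) (χ : Γ →* ℂ) (o : X) (hfix : ∀ γ : Γ, γ • o = o)
    (hL : ∃ L : Set X, IsClopen L ∧ IsCompact L ∧ o ∈ L) (γ₀ : Γ) (hγ₀ : χ γ₀ ≠ 1) :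
    ∃ x₀ ∈ ({o} : Set X) \ (∅ : Set X), ∃ γ₀' : Γ, γ₀' • x₀ = x₀ ∧ ∃ χ' : Γ →* ℂ, (∀ k ∈ K₀, χ' k = 1) ∧ χ γ₀' ≠ χ' γ₀' ∧
      ∃ T' : (X → ℂ) →ₗ[ℂ] ℂ,
        (∀ F : X → ℂ, IsLocallyConstant F → HasCompactSupport F → (∀ x ∈ (∅ : Set X), F x = 0) → ∀ γ : Γ,
          T' (fun z => F (γ • z)) = χ' γ * T' F) ∧
        (∀ F : X → ℂ, IsLocallyConstant F → HasCompactSupport F → (∀ x ∈ ({o} : Set X), F x = 0) → T' F = 0) ∧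
        ∃ F₁ : X → ℂ, IsLocallyConstant F₁ ∧ HasCompactSupport F₁ ∧ (∀ x ∈ (∅ : Set X), F₁ x = 0) ∧ T' F₁ ≠ 0 := by
  obtain ⟨L, hLc, hLK, hoL⟩ := hL
  refine ⟨o, ⟨Set.mem_singleton o, Set.notMem_empty o⟩, γ₀, hfix γ₀, 1, fun k _ => MonoidHom.one_apply k, ?_,
    LinearMap.proj o, ?_, ?_, ?_⟩
  · rwa [MonoidHom.one_apply]
  · intro F _ _ _ γ
    rw [LinearMap.proj_apply, LinearMap.proj_apply, MonoidHom.one_apply, one_mul, hfix]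
  · intro F _ _ hF0
    rw [LinearMap.proj_apply]
    exact hF0 o (Set.mem_singleton o)
  · refine ⟨L.indicator fun _ => (1 : ℂ), isLocallyConstant_indicator_of_isClopen hLc (IsLocallyConstant.const _),
      hasCompactSupport_indicator_of_isCompact hLK _, fun x hx => absurd hx (Set.notMem_empty x), ?_⟩
    rw [LinearMap.proj_apply, Set.indicator_of_mem hoL]
    exact one_ne_zero

end Vertex

section MeasureWitness

variable {Γ : Type*} [Group Γ] {X : Type*} [TopologicalSpace X] [MulAction Γ X] [ContinuousConstSMul Γ X]
  [MeasurableSpace X] [OpensMeasurableSpace X]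

/-- **A RELATIVELY INVARIANT RADON MEASURE ON A STRATUM IS A WITNESS FUNCTIONAL.**  `M′ ⊆ M`, `M` closed, `M′` `Γ`-stable; `μ` a measure on the stratum `M ∖ M′`, finite on its
compact sets, with `∫ F(γ • z) dμ(z) = χ′ γ · ∫ F dμ` for the lcc `F` on `X` vanishing on `M′`, and `∫ F₁ dμ ≠ 0` for one of them.  Then there is a linear `T′`
on `X → ℂ`, `= ∫ · dμ` on those `F`, `χ′`-semi-invariant on them, killing the lcc `F` vanishing on `M`, non-degenerate — the `T′` of
★ part 1 `kills_of_wrongChar_stratum`. [BernsteinZelevinsky1976, §1.18; KudlaRallis1990, §2–3] -/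
theorem exists_witness_of_measure (M M' : Set X) (hM : IsClosed M) (hM'M : M' ⊆ M) (hM'Γ : ∀ γ : Γ, ∀ x ∈ M', γ • x ∈ M')
    (μ : Measure ↥(M \ M')) [IsFiniteMeasureOnCompacts μ] (χ' : Γ →* ℂ)
    (hμ : ∀ F : X → ℂ, IsLocallyConstant F → HasCompactSupport F → (∀ x ∈ M', F x = 0) → ∀ γ : Γ,
      ∫ z, F (γ • (z : X)) ∂μ = χ' γ * ∫ z, F z ∂μ)
    (hpos : ∃ F₁ : X → ℂ, IsLocallyConstant F₁ ∧ HasCompactSupport F₁ ∧ (∀ x ∈ M', F₁ x = 0) ∧ ∫ z, F₁ z ∂μ ≠ 0) :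
    ∃ T' : (X → ℂ) →ₗ[ℂ] ℂ,
      (∀ F : X → ℂ, IsLocallyConstant F → HasCompactSupport F → (∀ x ∈ M', F x = 0) → T' F = ∫ z, F z ∂μ) ∧
      (∀ F : X → ℂ, IsLocallyConstant F → HasCompactSupport F → (∀ x ∈ M', F x = 0) → ∀ γ : Γ, T' (fun z => F (γ • z)) = χ' γ * T' F) ∧
      (∀ F : X → ℂ, IsLocallyConstant F → HasCompactSupport F → (∀ x ∈ M, F x = 0) → T' F = 0) ∧
      ∃ F₁ : X → ℂ, IsLocallyConstant F₁ ∧ HasCompactSupport F₁ ∧ (∀ x ∈ M', F₁ x = 0) ∧ T' F₁ ≠ 0 := by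
  -- the submodule of lcc functions vanishing on `M′`
  let V : Submodule ℂ (X → ℂ) :=
    { carrier := {F | IsLocallyConstant F ∧ HasCompactSupport F ∧ ∀ x ∈ M', F x = 0}
      add_mem' := fun {F F'} hF hF' => ⟨hF.1.add hF'.1, hF.2.1.add hF'.2.1, fun x hx => by
        rw [Pi.add_apply, hF.2.2 x hx, hF'.2.2 x hx, add_zero]⟩
      zero_mem' := ⟨IsLocallyConstant.const (0 : ℂ), HasCompactSupport.zero, fun _ _ => rfl⟩
      smul_mem' := fun a F hF => ⟨hF.1.comp fun z => a • z, hF.2.1.smul_left, fun x hx => by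
        rw [Pi.smul_apply, hF.2.2 x hx, smul_zero]⟩ }
  have hVmem : ∀ {F : X → ℂ}, F ∈ V ↔ IsLocallyConstant F ∧ HasCompactSupport F ∧ ∀ x ∈ M', F x = 0 := fun {F} => Iff.rfl
  have hint : ∀ {F : X → ℂ}, IsLocallyConstant F → HasCompactSupport F → (∀ x ∈ M', F x = 0) →
      Integrable (fun z : ↥(M \ M') => F z) μ := by
    intro F hF hFs hF0
    have h := lcc_restrict_sdiff hM hF hFs hF0
    exact h.1.continuous.integrable_of_hasCompactSupport h.2
  -- `∫ · dμ` is linear on `V`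
  let T₀ : V →ₗ[ℂ] ℂ :=
    { toFun := fun F => ∫ z, (F : X → ℂ) z ∂μ
      map_add' := fun F F' => by
        simpa only [Submodule.coe_add, Pi.add_apply] using
          integral_add (hint F.2.1 F.2.2.1 F.2.2.2) (hint F'.2.1 F'.2.2.1 F'.2.2.2)
      map_smul' := fun a F => by
        simpa only [Submodule.coe_smul, Pi.smul_apply, smul_eq_mul, RingHom.id_apply] using
          integral_const_mul a (fun z : ↥(M \ M') => (F : X → ℂ) z) }
  obtain ⟨T₁, hT₁⟩ := LinearMap.exists_extend T₀
  have hT₁V : ∀ F : X → ℂ, IsLocallyConstant F → HasCompactSupport F → (∀ x ∈ M', F x = 0) → T₁ F = ∫ z, F z ∂μ := fun F hF hFs hF0 => by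
    have := LinearMap.congr_fun hT₁ ⟨F, hVmem.2 ⟨hF, hFs, hF0⟩⟩
    simpa [T₀] using this
  refine ⟨T₁, hT₁V, fun F hF hFs hF0 γ => ?_, fun F hF hFs hFM => ?_, ?_⟩
  · have hF' : IsLocallyConstant fun y => F (γ • y) := hF.comp_continuous (continuous_const_smul γ)
    have hFs' : HasCompactSupport fun y => F (γ • y) := hFs.comp_homeomorph (Homeomorph.smul γ)
    have hF0' : ∀ x ∈ M', F (γ • x) = 0 := fun x hx => hF0 _ (hM'Γ γ x hx)
    rw [hT₁V _ hF' hFs' hF0', hT₁V F hF hFs hF0, hμ F hF hFs hF0 γ]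
  · rw [hT₁V F hF hFs fun x hx => hFM x (hM'M hx)]
    have h0 : (fun z : ↥(M \ M') => F z) = fun _ => 0 := funext fun z => hFM z z.2.1
    rw [h0, integral_zero]
  · obtain ⟨F₁, hF₁, hF₁s, hF₁0, hF₁ne⟩ := hpos
    exact ⟨F₁, hF₁, hF₁s, hF₁0, by rwa [hT₁V F₁ hF₁ hF₁s hF₁0]⟩

end MeasureWitness

end Summit.HodgeConjecture.HodgeConjecture.Cruxes.HLiu418.K2LiuNullConeMultiplicityOneStratified

end
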